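import Mathlib
import HarnessLib
import Literature.Geometry.DiscreteGeometry.BondGraph
import Literature.Geometry.DiscreteGeometry.KissingPatterns
import Summits.AtomisticToContinuum.Crystallization.Theorems.PricedLinkCensusSoftLayerPropagationStubDevelopStep

/-!
# The ordered shadow development: reduction of `stub_develop` to three local facts (crux `SoftLayerPropagation`, line `Sketch`)

Route `PricedLinkCensus`, crux `SoftLayerPropagation` (stmt-AtomisticToContinuum-14233), line
`Sketch`, helper file for the stub `stub_develop` (development of the exact shadow crystal on the
graph `5`-ball): registered sub-goal `develop_reduction`.

`develop_reduction` has EXACTLY the conclusion of `stub_develop` — a shadow `D : Fin N → ℝ³`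
which, at every site `j` joined to `i` by a bond walk of length `≤ 5`, carries the bond-neighbours
of `j` exactly onto a rotated FCC/HCP pattern about `D j`, is `nn_j/4`-close to the real bond
vectors after a rotation, and realises the bonds among neighbours as the unit distances — and
reduces it to data and LOCAL hypotheses:

* charts as functions `Pc, Ac, mc` of the site (pattern, isometry, labels, as delivered by
  `stub_chartAssembly`), valid with `nn > 0` at every site IN SCOPE: `f ≤ R₁` or a neighbour of
  such a site, for a potential `f : Fin N → ℝ` (intended `f v = dist (y i) (y v)`,
  `R₁ ≈ 6.5 nn_i`) with `f ≤ R₁` on the graph `5`-ball (`Hcover`);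
* `HO` (handedness of contact tetrahedra agrees in the charts of bonded sites), `HX` (coned
  squares: no merging of second-shell sites), `H1` (ordered caps) — see `…StubDevelopStep.lean`.

Proof: iterate `develop_step` along the strict total order `(f v, v)` (induction on the rank
`#{w ∣ w earlier than v}`), starting from arbitrary frames; at the end every site with `f ≤ R₁`
has all its edges compatible, and compatibility along the twelve edges of `j` is precisely the
exactness of the star of `j` (`Q := Q j`, `R := A_j ∘ Q_j⁻¹`).  What is NOT here: the three local
hypotheses (metric facts about charge-free configurations at `η ≤ 1/100`; `HO` and `HX` need
bond-length rigidity of small contact clusters, not only the `nn/4`-charts) and `Hcover` (the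
reach estimate `Σ_(t<6) 1.01^t nn_i < 8 nn_i`).  All `[folklore]`.
-/

noncomputable section

namespace Summit.AtomisticToContinuum.Crystallization.Theorems

open Literature.Geometry.DiscreteGeometry

/-- **Registered sub-goal `develop_reduction`** of the crux item: the conclusion of `stub_develop`
(exact development of the shadow crystal on the graph `5`-ball about `i`) from charts in scope and
the three local hypotheses `HO`, `HX`, `H1` of `develop_step`, for any potential `f` with
`f ≤ R₁` on the graph `5`-ball. [folklore] -/
theorem develop_reduction :  ∀ (η : ℝ) (N : ℕ) (y : Fin N → EuclideanSpace ℝ (Fin 3)) (Pc : Fin N → Finset (EuclideanSpace ℝ (Fin 3))) (Ac : Fin N → EuclideanSpace ℝ (Fin 3) →ₗᵢ[ℝ] EuclideanSpace ℝ (Fin 3)) (mc : Fin N → EuclideanSpace ℝ (Fin 3) → Fin N) (f : Fin N → ℝ) (R₁ : ℝ) (R₂ : ℝ) (i : Fin N),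
    (∀ v, f v ≤ R₂ → ∃ ν : ℝ, Literature.Geometry.DiscreteGeometry.nearestDist y v = ν ∧ 0 < ν ∧
      ((Pc v = Literature.Geometry.DiscreteGeometry.fccKissingPattern ∨ Pc v = Literature.Geometry.DiscreteGeometry.hcpKissingPattern) ∧ (∀ p ∈ Pc v, (Literature.Geometry.DiscreteGeometry.bondGraph η y).Adj v (mc v p) ∧ dist (y (mc v p)) (y v + ν • Ac v p) ≤ ν / 4) ∧ (∀ p ∈ Pc v, ∀ q ∈ Pc v, mc v p = mc v q → p = q) ∧ (∀ p ∈ Pc v, ∀ q ∈ Pc v, ((Literature.Geometry.DiscreteGeometry.bondGraph η y).Adj (mc v p) (mc v q) ↔ dist p q = 1)) ∧ (∀ l, (Literature.Geometry.DiscreteGeometry.bondGraph η y).Adj v l → ∃ p ∈ Pc v, mc v p = l))) →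
    (∀ v w, (Literature.Geometry.DiscreteGeometry.bondGraph η y).Adj w v → f w ≤ R₁ → f v ≤ R₂) → R₁ ≤ R₂ →
    (∀ j k, f j ≤ R₂ → f k ≤ R₂ → (Literature.Geometry.DiscreteGeometry.bondGraph η y).Adj j k → (∀ a b, (Literature.Geometry.DiscreteGeometry.bondGraph η y).Adj j a → (Literature.Geometry.DiscreteGeometry.bondGraph η y).Adj j b → (Literature.Geometry.DiscreteGeometry.bondGraph η y).Adj k a → (Literature.Geometry.DiscreteGeometry.bondGraph η y).Adj k b → (Literature.Geometry.DiscreteGeometry.bondGraph η y).Adj a b → ∀ p₁ ∈ Pc j, ∀ p₂ ∈ Pc j, ∀ p₃ ∈ Pc j, mc j p₁ = k → mc j p₂ = a → mc j p₃ = b → ∀ q₁ ∈ Pc k, ∀ q₂ ∈ Pc k, ∀ q₃ ∈ Pc k, mc k q₁ = j → mc k q₂ = a → mc k q₃ = b → Matrix.det ![WithLp.ofLp p₁, WithLp.ofLp p₂, WithLp.ofLp p₃] = - Matrix.det ![WithLp.ofLp q₁, WithLp.ofLp q₂, WithLp.ofLp q₃])) →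
    (∀ x u k t, f x ≤ R₁ → (Literature.Geometry.DiscreteGeometry.bondGraph η y).Adj x u → (Literature.Geometry.DiscreteGeometry.bondGraph η y).Adj x k → ¬ (Literature.Geometry.DiscreteGeometry.bondGraph η y).Adj u k → u ≠ k → ¬ (Literature.Geometry.DiscreteGeometry.bondGraph η y).Adj x t → x ≠ t → (Literature.Geometry.DiscreteGeometry.bondGraph η y).Adj t u → (Literature.Geometry.DiscreteGeometry.bondGraph η y).Adj t k → ∃ c, (Literature.Geometry.DiscreteGeometry.bondGraph η y).Adj x c ∧ (Literature.Geometry.DiscreteGeometry.bondGraph η y).Adj u c ∧ (Literature.Geometry.DiscreteGeometry.bondGraph η y).Adj k c ∧ (Literature.Geometry.DiscreteGeometry.bondGraph η y).Adj t c) →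
    (∀ u t k, f u ≤ R₁ → (Literature.Geometry.DiscreteGeometry.bondGraph η y).Adj u t → (Literature.Geometry.DiscreteGeometry.bondGraph η y).Adj t k → ¬ (Literature.Geometry.DiscreteGeometry.bondGraph η y).Adj u k → u ≠ k → (f k < f u ∨ (f k = f u ∧ k < u)) → (f u < f t ∨ (f u = f t ∧ u < t)) → ∃ c, (Literature.Geometry.DiscreteGeometry.bondGraph η y).Adj u c ∧ (f c < f u ∨ (f c = f u ∧ c < u)) ∧ ((Literature.Geometry.DiscreteGeometry.bondGraph η y).Adj c t ∨ (Literature.Geometry.DiscreteGeometry.bondGraph η y).Adj c k)) →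
    (∀ j, (∃ w : (Literature.Geometry.DiscreteGeometry.bondGraph η y).Walk i j, w.length ≤ 5) → f j ≤ R₁) →
    ∃ D : Fin N → EuclideanSpace ℝ (Fin 3),
      ∀ j : Fin N, (∃ w : (Literature.Geometry.DiscreteGeometry.bondGraph η y).Walk i j, w.length ≤ 5) →
        ∃ (P : Finset (EuclideanSpace ℝ (Fin 3)))
          (Q R : EuclideanSpace ℝ (Fin 3) →ₗᵢ[ℝ] EuclideanSpace ℝ (Fin 3)),
          (P = Literature.Geometry.DiscreteGeometry.fccKissingPattern ∨
            P = Literature.Geometry.DiscreteGeometry.hcpKissingPattern) ∧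
          D '' {k | (Literature.Geometry.DiscreteGeometry.bondGraph η y).Adj j k} =
            (fun p => D j + Q p) '' (P : Set (EuclideanSpace ℝ (Fin 3))) ∧
          (∀ k, (Literature.Geometry.DiscreteGeometry.bondGraph η y).Adj j k →
            ‖(y k - y j) - Literature.Geometry.DiscreteGeometry.nearestDist y j • R (D k - D j)‖ ≤
              Literature.Geometry.DiscreteGeometry.nearestDist y j / 4) ∧
          (∀ k k', (Literature.Geometry.DiscreteGeometry.bondGraph η y).Adj j k →
            (Literature.Geometry.DiscreteGeometry.bondGraph η y).Adj j k' →
            ((Literature.Geometry.DiscreteGeometry.bondGraph η y).Adj k k' ↔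
              dist (D k) (D k') = 1)) := by
  intro η N y Pc Ac mc f R₁ R₂ i hscope₂ hnbr hR hO₂ hX h1 hcover
  -- scope in the form consumed by `develop_step`
  have toR₂ : ∀ v : Fin N, (f v ≤ R₁ ∨ ∃ w, (bondGraph η y).Adj w v ∧ f w ≤ R₁) → f v ≤ R₂ := by
    intro v hv
    rcases hv with hv | ⟨w, hwv, hw⟩
    · exact hv.trans hR
    · exact hnbr v w hwv hw
  have hscope : (∀ v : Fin N, (f v ≤ R₁ ∨ ∃ w, (bondGraph η y).Adj w v ∧ f w ≤ R₁) → 0 < nearestDist y v ∧ ((Pc v = fccKissingPattern ∨ Pc v = hcpKissingPattern) ∧ (∀ p ∈ Pc v, (bondGraph η y).Adj v (mc v p) ∧ dist (y (mc v p)) (y v + nearestDist y v • Ac v p) ≤ nearestDist y v / 4) ∧ (∀ p ∈ Pc v, ∀ q ∈ Pc v, mc v p = mc v q → p = q) ∧ (∀ p ∈ Pc v, ∀ q ∈ Pc v, ((bondGraph η y).Adj (mc v p) (mc v q) ↔ dist p q = 1)) ∧ (∀ l, (bondGraph η y).Adj v l → ∃ p ∈ Pc v, mc v p = l))) := by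
    intro v hv
    obtain ⟨ν, hν, hpos, hc⟩ := hscope₂ v (toR₂ v hv)
    subst hν
    exact ⟨hpos, hc⟩
  have hO : (∀ j k : Fin N, (f j ≤ R₁ ∨ ∃ w, (bondGraph η y).Adj w j ∧ f w ≤ R₁) → (f k ≤ R₁ ∨ ∃ w, (bondGraph η y).Adj w k ∧ f w ≤ R₁) → (bondGraph η y).Adj j k → (∀ a b : Fin N, (bondGraph η y).Adj j a → (bondGraph η y).Adj j b → (bondGraph η y).Adj k a → (bondGraph η y).Adj k b → (bondGraph η y).Adj a b → ∀ p₁ ∈ Pc j, ∀ p₂ ∈ Pc j, ∀ p₃ ∈ Pc j, mc j p₁ = k → mc j p₂ = a → mc j p₃ = b → ∀ q₁ ∈ Pc k, ∀ q₂ ∈ Pc k, ∀ q₃ ∈ Pc k, mc k q₁ = j → mc k q₂ = a → mc k q₃ = b → Matrix.det ![WithLp.ofLp p₁, WithLp.ofLp p₂, WithLp.ofLp p₃] = - Matrix.det ![WithLp.ofLp q₁, WithLp.ofLp q₂, WithLp.ofLp q₃])) := fun j k hj hk hjk => hO₂ j k (toR₂ j hj) (toR₂ k hk) hjk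
  classical
  /- Step 1: the order `(f v, v)` and its rank. -/
  set rk : Fin N → ℕ := fun v => (Finset.univ.filter fun w => (f w < f v ∨ (f w = f v ∧ w < v))).card with hrk
  have etrans : ∀ a b c : Fin N, (f a < f b ∨ (f a = f b ∧ a < b)) → (f b < f c ∨ (f b = f c ∧ b < c)) → (f a < f c ∨ (f a = f c ∧ a < c)) := by
    intro a b c hab hbc
    rcases hab with h | ⟨h, h'⟩ <;> rcases hbc with g | ⟨g, g'⟩
    · exact Or.inl (h.trans g)
    · exact Or.inl (h.trans_eq g)
    · exact Or.inl (h.trans_lt g)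
    · exact Or.inr ⟨h.trans g, h'.trans g'⟩
  have eirr : ∀ a : Fin N, ¬ (f a < f a ∨ (f a = f a ∧ a < a)) := by
    intro a h
    rcases h with h | ⟨-, h⟩
    · exact lt_irrefl _ h
    · exact lt_irrefl _ h
  have etot : ∀ a b : Fin N, a ≠ b → (f a < f b ∨ (f a = f b ∧ a < b)) ∨ (f b < f a ∨ (f b = f a ∧ b < a)) := by
    intro a b hab
    rcases lt_trichotomy (f a) (f b) with h | h | h
    · exact Or.inl (Or.inl h)
    · rcases lt_trichotomy a b with h' | h' | h'
      · exact Or.inl (Or.inr ⟨h, h'⟩)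
      · exact absurd h' hab
      · exact Or.inr (Or.inr ⟨h.symm, h'⟩)
    · exact Or.inr (Or.inl h)
  have rk_lt : ∀ a b : Fin N, (f a < f b ∨ (f a = f b ∧ a < b)) → rk a < rk b := by
    intro a b hab
    apply Finset.card_lt_card
    refine (Finset.ssubset_iff_of_subset ?_).2 ⟨a, ?_, ?_⟩
    · intro w hw
      simp only [Finset.mem_filter, Finset.mem_univ, true_and] at hw ⊢
      exact etrans w a b hw hab
    · simpa using hab
    · simp
  have e_of_rk_lt : ∀ a b : Fin N, rk a < rk b → (f a < f b ∨ (f a = f b ∧ a < b)) := by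
    intro a b hlt
    rcases eq_or_ne a b with rfl | hne
    · exact absurd hlt (lt_irrefl _)
    · rcases etot a b hne with h | h
      · exact h
      · exact absurd (rk_lt b a h) (lt_asymm hlt)
  have eq_of_rk_eq : ∀ a b : Fin N, rk a = rk b → a = b := by
    intro a b hab
    by_contra hne
    rcases etot a b hne with h | h
    · exact absurd hab (rk_lt a b h).ne
    · exact absurd hab (rk_lt b a h).ne'
  /- Step 2: iterate `develop_step`. -/
  have iter : ∀ n : ℕ, ∃ (D : Fin N → EuclideanSpace ℝ (Fin 3)) (Q : Fin N → EuclideanSpace ℝ (Fin 3) →ₗᵢ[ℝ] EuclideanSpace ℝ (Fin 3)),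
      ∀ v : Fin N, rk v < n → f v ≤ R₁ → (∀ t : Fin N, (bondGraph η y).Adj v t → ((∀ p ∈ Pc v, ∀ p' ∈ Pc t, mc v p = mc t p' → D v + Q v p = D t + Q t p') ∧ (∀ p ∈ Pc v, mc v p = t → D v + Q v p = D t) ∧ (∀ p' ∈ Pc t, mc t p' = v → D t + Q t p' = D v))) := by
    intro n
    induction n with
    | zero => exact ⟨fun _ => 0, fun _ => LinearIsometry.id, fun v hv => absurd hv (Nat.not_lt_zero _)⟩
    | succ n ih =>
      obtain ⟨D, Q, hDQ⟩ := ih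
      by_cases hex : ∃ u, rk u = n ∧ f u ≤ R₁
      · obtain ⟨u, hru, hfu⟩ := hex
        have hgood : ∀ v, (f v < f u ∨ (f v = f u ∧ v < u)) → (∀ t : Fin N, (bondGraph η y).Adj v t → ((∀ p ∈ Pc v, ∀ p' ∈ Pc t, mc v p = mc t p' → D v + Q v p = D t + Q t p') ∧ (∀ p ∈ Pc v, mc v p = t → D v + Q v p = D t) ∧ (∀ p' ∈ Pc t, mc t p' = v → D t + Q t p' = D v))) := by
          intro v hv
          refine hDQ v (hru ▸ rk_lt v u hv) (le_trans ?_ hfu)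
          rcases hv with h | ⟨h, -⟩
          · exact h.le
          · exact h.le
        obtain ⟨D', Q', h'⟩ := develop_step η N y Pc Ac mc f R₁ hscope hO hX h1 u hfu D Q hgood
        refine ⟨D', Q', fun v hv _ => h' v ?_⟩
        rcases (Nat.lt_succ_iff.1 hv).lt_or_eq with h | h
        · exact Or.inl (e_of_rk_lt v u (hru ▸ h))
        · exact Or.inr (eq_of_rk_eq v u (h.trans hru.symm))
      · refine ⟨D, Q, fun v hv hfv => hDQ v ?_ hfv⟩
        rcases (Nat.lt_succ_iff.1 hv).lt_or_eq with h | h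
        · exact h
        · exact absurd ⟨v, h, hfv⟩ hex
  obtain ⟨D, Q, hDQ⟩ := iter (N + 1)
  have hall : ∀ v : Fin N, f v ≤ R₁ → (∀ t : Fin N, (bondGraph η y).Adj v t → ((∀ p ∈ Pc v, ∀ p' ∈ Pc t, mc v p = mc t p' → D v + Q v p = D t + Q t p') ∧ (∀ p ∈ Pc v, mc v p = t → D v + Q v p = D t) ∧ (∀ p' ∈ Pc t, mc t p' = v → D t + Q t p' = D v))) := by
    intro v hv
    refine hDQ v (lt_of_le_of_lt (Finset.card_filter_le _ _) ?_) hv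
    simp
  /- Step 3: compatibility along the twelve edges of `j` is exactness of its star. -/
  refine ⟨D, fun j hw => ?_⟩
  have hfj : f j ≤ R₁ := hcover j hw
  obtain ⟨hν, hP, C2, C3, C4, C5⟩ := hscope j (Or.inl hfj)
  have goodj := hall j hfj
  have hDk : ∀ p ∈ Pc j, D (mc j p) = D j + Q j p :=
    fun p hp => ((goodj (mc j p) (C2 p hp).1).2.1 p hp rfl).symm
  set Qe : EuclideanSpace ℝ (Fin 3) ≃ₗᵢ[ℝ] EuclideanSpace ℝ (Fin 3) := (Q j).toLinearIsometryEquiv rfl with hQe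
  have hQe : ∀ p, Qe.symm (Q j p) = p := fun p => Qe.symm_apply_apply p
  refine ⟨Pc j, Q j, (Ac j).comp Qe.symm.toLinearIsometry, hP, ?_, ?_, ?_⟩
  · ext z
    simp only [Set.mem_image, Set.mem_setOf_eq, Finset.mem_coe]
    constructor
    · rintro ⟨k, hk, rfl⟩
      obtain ⟨p, hp, rfl⟩ := C5 k hk
      exact ⟨p, hp, (hDk p hp).symm⟩
    · rintro ⟨p, hp, rfl⟩
      exact ⟨mc j p, (C2 p hp).1, hDk p hp⟩
  · intro k hk
    obtain ⟨p, hp, rfl⟩ := C5 k hk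
    have h := (C2 p hp).2
    rw [dist_eq_norm] at h
    rw [hDk p hp, add_sub_cancel_left, LinearIsometry.coe_comp, Function.comp_apply,
      LinearIsometryEquiv.coe_toLinearIsometry, hQe, sub_sub]
    exact h
  · intro k k' hk hk'
    obtain ⟨p, hp, rfl⟩ := C5 k hk
    obtain ⟨q, hq, rfl⟩ := C5 k' hk'
    rw [hDk p hp, hDk q hq, dist_add_left, (Q j).isometry.dist_eq]
    exact C4 p hp q hq

end Summit.AtomisticToContinuum.Crystallization.Theorems

end
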